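import Literature.Geometry.Lorentzian.KerrRedShiftBulk
import Literature.Geometry.Lorentzian.KerrNullFrameFlux
import HarnessLib

/-!
# The Dafermos–Rodnianski red-shift on the Kerr horizon with explicit constants:
# `K^N ≥ ½h₁ λ² + ¼f₁ |q̸|² + ((r₊ − M)/(2Σ)) v²` on `𝓗⁺` as soon as `(r₊ − M)h₁, (r₊ − M)f₁ ≥ 16`
# (helper for support item `stmt-FinalStateConjecture-10751`, `AxisymmetricKappaWaveDecay`, clause (a))

Clause (a) of `AxisymmetricKappaWaveDecay` (route `PhaseMixingCapture`) is the uniform boundedness of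
the non-degenerate energy of axisymmetric waves on sub-extremal Kerr with constants that are explicit
powers of `1 − (a/M)²`, i.e. of the surface gravity `κ`. On paper this is the red-shift argument of
Dafermos–Rodnianski (arXiv:0811.0354, §3.3.2 and Thm. 7.1) with the constants tracked: its only
`κ`-dependent input is the positivity `K^N ≥ b J^N·N` of the bulk term of the red-shift vector field
`N` near `𝓗⁺`, where the printed proof chooses the parameter "`σ` large enough" and obtains `b` "from
`κ > 0`" without rates. `KerrRedShiftBulk.lean` computes the bulk term of
`N = (1 + h₁(r − r₊))K + (1 + f₁(r − r₊))k` (`Kerr.redShiftVector`) ON the horizon exactly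
(`Kerr.multiplierBulk_redShiftVector_of_radius_eq_rPlus`):
`K^N|_{𝓗⁺} = 2H h₁ λ² + ½ f₁ |q̸|² + ((r₊ − M)/Σ) v² − (4Hr₊/Σ) λ v + (2r₊/Σ) v (q̸·∇̸r)`,
`λ = dw(K)`, `v = dw(k)`, `q̸ = dw + v dr` (angular part), and leaves "the positivity of the horizon
form for large `f₁, h₁`" to sequel files. This file proves that positivity with EXPLICIT thresholds and
EXPLICIT coercivity constants, uniformly on the whole sub-extremal range `|a| < M`:

* `Kerr.scalarH_horizon_bounds` — on `𝓗⁺`: `1 ≤ 2H ≤ 2` and `|∇̸r|² ≤ 1` (`2H = 1 + |∇̸r|²`,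
  `|∇̸r|² = (r₊² + a² − Σ)/Σ`, `a² ≤ r₊² ≤ Σ ≤ r₊² + a²`);
* `Kerr.redShift_horizon_coercive` — **for `|a| < M`, `r(x) = r₊` and any parameters with
  `16 ≤ (r₊ − M) h₁`, `16 ≤ (r₊ − M) f₁`:**
  `½ h₁ λ² + ¼ f₁ |q̸|² + ((r₊ − M)/(2Σ)) v² ≤ K^N` for every `w : E4 → ℝ`
  (the two cross terms are absorbed by `¼` of the red-shift term each, Young's inequality, using
  `H ∈ [½, 1]`, `r₊² ≤ Σ`, `|∇̸r|² ≤ 1`);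
* `Kerr.redShift_horizon_coercive_sixteen_div` — the admissible choice `h₁ = f₁ = 16/(r₊ − M)`:
  `K^N ≥ (8/(r₊ − M)) λ² + (4/(r₊ − M)) |q̸|² + ((r₊ − M)/(2Σ)) v²`;
* `Kerr.redShift_horizon_coercive_kappa` — in terms of the surface gravity
  `κ = Kerr.surfaceGravity M a`: with `h₁ = f₁ = 8/(M²κ)`, `K^N ≥ (κ/2)(λ² + v² + |q̸|²)` on `𝓗⁺`
  (coercivity `≍ κ` on the whole null-frame energy density, multiplier of size `16/(M²κ)`).

Since `r₊ − M = √(M² − a²) = M (1 − (a/M)²)^{1/2}` (`Kerr.rPlus_sub_self`) and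
`(r₊ − M)/Σ = 2Hκ` on `𝓗⁺` (`Kerr.redShiftCoeff_eq_surfaceGravity`), this is the statement
"`K^N ≥ b J^N·N` on `𝓗⁺` with `b ≍ κ` for a multiplier of size `≍ κ⁻¹`": the `κ`-explicit seed of the
red-shift estimate (the transversal weight degenerates exactly like `κ`, the price in the tangential
components is exactly `κ⁻¹`). The propagation off the horizon (the exact formula
`Kerr.multiplierBulk_redShiftVector` on a collar of width `∝ r₊ − M`) and the energy identity are not
done here.
-/

noncomputable section

open Set Filter
open scoped Topology

namespace Literature.Geometry.Lorentzian.Kerr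

variable {M a : ℝ} {x : E4}

/-! ### Bounds for `H` and `|∇̸r|²` on the horizon -/

/-- **On the horizon `1 ≤ 2H ≤ 2` and `|∇̸r|² ≤ 1`.** At a point with `r = r₊` of a sub-extremal
Kerr chart: `2H = 1 + |∇̸r|²` (`Kerr.one_sub_two_mul_scalarH_of_radius_eq_rPlus`), `|∇̸r|² ≥ 0`, and
`|∇̸r|² = (r₊² + a² − Σ)/Σ ≤ 1` because `a² < M² ≤ r₊² ≤ Σ`. [folklore] -/
theorem scalarH_horizon_bounds (hMa : IsSubextremal M a) (hr : radius a x = rPlus M a) :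
    1 ≤ 2 * scalarH M a x ∧ 2 * scalarH M a x ≤ 2 ∧ 0 ≤ frameAngSq a x (dRadius a x) ∧
      frameAngSq a x (dRadius a x) ≤ 1 := by
  have hM : 0 < M := hMa.pos
  have hMa' : |a| ≤ M := le_of_lt hMa
  have hx : 0 < radius a x := hr ▸ rPlus_pos hM a
  have hS := blSigma_spatial_pos hx
  have hH := one_sub_two_mul_scalarH_of_radius_eq_rPlus hMa' hM hr
  have hD0 : 0 ≤ frameAngSq a x (dRadius a x) := frameAngSq_nonneg hx _
  have hD1 : frameAngSq a x (dRadius a x) ≤ 1 := by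
    rw [frameAngSq_dRadius hx, div_le_one hS]
    have h1 := sq_le_blSigma_spatial (a := a) hx
    have h2 : a ^ 2 ≤ radius a x ^ 2 := by
      have hMr : M ≤ radius a x := by
        rw [hr]; linarith [rPlus_sub_self M a, Real.sqrt_nonneg (M ^ 2 - a ^ 2)]
      have haM : |a| ^ 2 ≤ M ^ 2 := pow_le_pow_left₀ (abs_nonneg a) hMa' 2
      rw [sq_abs] at haM
      nlinarith
    linarith
  exact ⟨by linarith, by linarith, hD0, hD1⟩

/-! ### The horizon form is coercive for `(r₊ − M) h₁, (r₊ − M) f₁ ≥ 16` -/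

/-- The real-algebra core of `redShift_horizon_coercive`: with `δ = r₊ − M > 0`, `S = Σ > 0`,
`2H = 1 + D`, `0 ≤ D ≤ 1`, `0 ≤ Q`, `r² ≤ S`, `A² ≤ Q D` (Cauchy–Schwarz) and thresholds
`16 ≤ δ h₁`, `16 ≤ δ f₁`, the horizon form dominates `½h₁ λ² + ¼f₁ Q + (δ/(2S)) v²` (each cross term
costs `δ/(4S) v²` by Young's inequality, the rest is absorbed by `H ∈ [½, 1]`, `r² ≤ S`, `D ≤ 1`).
[folklore] -/
theorem redShift_horizon_algebra {δ S H D Q A lam v r h₁ f₁ : ℝ} (hδ : 0 < δ) (hS : 0 < S)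
    (hH : 2 * H = 1 + D) (hD0 : 0 ≤ D) (hD1 : D ≤ 1) (hQ : 0 ≤ Q) (hrS : r ^ 2 ≤ S)
    (hCS : A ^ 2 ≤ Q * D) (hh : 16 ≤ δ * h₁) (hf : 16 ≤ δ * f₁) :
    h₁ / 2 * lam ^ 2 + f₁ / 4 * Q + δ / (2 * S) * v ^ 2 ≤
      2 * H * h₁ * lam ^ 2 + 2⁻¹ * f₁ * Q + δ / S * v ^ 2 - 4 * H * r / S * lam * v +
        2 * r / S * v * A := by
  -- Young's inequality for the two cross terms (multiplied by `δ`)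
  have y1 : 4 * H * r * δ * lam * v ≤ δ ^ 2 / 4 * v ^ 2 + 16 * H ^ 2 * r ^ 2 * lam ^ 2 := by
    nlinarith [sq_nonneg (δ * v / 2 - 4 * H * r * lam)]
  have y2 : -(2 * r * δ * v * A) ≤ δ ^ 2 / 4 * v ^ 2 + 4 * r ^ 2 * A ^ 2 := by
    nlinarith [sq_nonneg (δ * v / 2 + 2 * r * A)]
  -- absorption of `4 r² A²` by `¼ δ f₁ S Q`
  have c1 : r ^ 2 * A ^ 2 ≤ r ^ 2 * (Q * D) := mul_le_mul_of_nonneg_left hCS (sq_nonneg r)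
  have c2 : r ^ 2 * (Q * D) ≤ r ^ 2 * Q := by
    have : 0 ≤ r ^ 2 * Q * (1 - D) := mul_nonneg (mul_nonneg (sq_nonneg r) hQ) (by linarith)
    nlinarith [this]
  have c3 : r ^ 2 * Q ≤ S * Q := mul_le_mul_of_nonneg_right hrS hQ
  have c4 : 16 * (S * Q) ≤ δ * f₁ * (S * Q) :=
    mul_le_mul_of_nonneg_right hf (mul_nonneg hS.le hQ)
  -- absorption of `16 H² r² λ²` by `δ h₁ (2H − ½) S λ²`
  have hHlo : 2⁻¹ ≤ H := by linarith
  have hHhi : H ≤ 1 := by linarith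
  have hHq : H ^ 2 ≤ 2 * H - 2⁻¹ := by nlinarith [mul_nonneg (sub_nonneg.2 hHlo) (sub_nonneg.2 hHhi)]
  have c5 : H ^ 2 * r ^ 2 * lam ^ 2 ≤ H ^ 2 * S * lam ^ 2 := by
    have : 0 ≤ H ^ 2 * lam ^ 2 * (S - r ^ 2) :=
      mul_nonneg (mul_nonneg (sq_nonneg H) (sq_nonneg lam)) (by linarith)
    nlinarith [this]
  have c6 : 16 * (H ^ 2 * S * lam ^ 2) ≤ δ * h₁ * (H ^ 2 * S * lam ^ 2) :=
    mul_le_mul_of_nonneg_right hh (mul_nonneg (mul_nonneg (sq_nonneg H) hS.le) (sq_nonneg lam))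
  have hδh : 0 ≤ δ * h₁ := by linarith
  have c7 : δ * h₁ * (H ^ 2 * S * lam ^ 2) ≤ δ * h₁ * ((2 * H - 2⁻¹) * S * lam ^ 2) := by
    refine mul_le_mul_of_nonneg_left ?_ hδh
    exact mul_le_mul_of_nonneg_right (mul_le_mul_of_nonneg_right hHq hS.le) (sq_nonneg lam)
  -- clear the denominator `S` and conclude (everything is linear in the monomials)
  rw [← sub_nonneg]
  have key : 2 * H * h₁ * lam ^ 2 + 2⁻¹ * f₁ * Q + δ / S * v ^ 2 - 4 * H * r / S * lam * v +
        2 * r / S * v * A - (h₁ / 2 * lam ^ 2 + f₁ / 4 * Q + δ / (2 * S) * v ^ 2) =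
      ((2 * H - 2⁻¹) * h₁ * S * lam ^ 2 + f₁ / 4 * S * Q + δ / 2 * v ^ 2 - 4 * H * r * lam * v +
        2 * r * v * A) / S := by
    field_simp
    ring
  rw [key]
  refine div_nonneg ?_ hS.le
  -- multiply by `δ > 0`
  refine nonneg_of_mul_nonneg_right (a := δ) ?_ hδ
  nlinarith [y1, y2, c1, c2, c3, c4, c5, c6, c7]

/-- **The red-shift on the Kerr horizon, with explicit constants** (Dafermos–Rodnianski,
arXiv:0811.0354, §3.3.2 and Thm. 7.1, "`K^N ≥ b J^N·N` on `𝓗⁺` for `σ` large enough", made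
quantitative on the Kerr horizon for the vector field `Kerr.redShiftVector M a h₁ f₁` of
`KerrRedShiftBulk.lean`). Let `|a| < M` and let `x` be a point of the future event horizon
`r(x) = r₊`. If the multiplier parameters satisfy `16 ≤ (r₊ − M) h₁` and `16 ≤ (r₊ − M) f₁`, then for
every `w : E4 → ℝ`, with `p = dw(x)`, `λ = p(K)` (`Kerr.hawkingComp`), `v = p(k)` (`Kerr.frameIn`) and
angular part `q̸ = (p + v dr)` (`Kerr.frameAngSq`),
`½ h₁ λ² + ¼ f₁ |q̸|² + ((r₊ − M)/(2Σ)) v² ≤ K^N(x)`.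
Here `r₊ − M = √(M² − a²)` and `(r₊ − M)/Σ = 2Hκ` (`Kerr.redShiftCoeff_eq_surfaceGravity`): the
transversal coercivity is `≍ κ`, bought with a multiplier of size `≍ κ⁻¹` — both explicit, uniformly
on the sub-extremal range. [cite: DafermosRodnianski2008, §3.3.2 and Thm. 7.1] -/
theorem redShift_horizon_coercive (hMa : IsSubextremal M a) (hr : radius a x = rPlus M a)
    {h₁ f₁ : ℝ} (hh : 16 ≤ (rPlus M a - M) * h₁) (hf : 16 ≤ (rPlus M a - M) * f₁) (w : E4 → ℝ) :
    h₁ / 2 * hawkingComp M a x (fun μ ↦ fderiv ℝ w x (E4.basisVector μ)) ^ 2 +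
        f₁ / 4 * frameAngSq a x ((fun μ ↦ fderiv ℝ w x (E4.basisVector μ)) +
          frameIn a x (fun μ ↦ fderiv ℝ w x (E4.basisVector μ)) • dRadius a x) +
        (rPlus M a - M) / (2 * blSigma a (E4.spatial x)) *
          frameIn a x (fun μ ↦ fderiv ℝ w x (E4.basisVector μ)) ^ 2 ≤
      KerrSchild.multiplierBulk (inverseMetric M a) (redShiftVector M a h₁ f₁) w x := by
  have hM : 0 < M := hMa.pos
  have hMa' : |a| ≤ M := le_of_lt hMa
  have hx : 0 < radius a x := hr ▸ rPlus_pos hM a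
  have hS := blSigma_spatial_pos hx
  have hδ : 0 < rPlus M a - M := by
    rw [rPlus_sub_self]
    refine Real.sqrt_pos.2 (sub_pos.2 ?_)
    have ha : |a| < M := hMa
    have := sq_lt_sq' (abs_lt.1 ha).1 (abs_lt.1 ha).2
    simpa using this
  obtain ⟨hH1, _, hD0, hD1⟩ := scalarH_horizon_bounds hMa hr
  have hH := one_sub_two_mul_scalarH_of_radius_eq_rPlus hMa' hM hr
  rw [multiplierBulk_redShiftVector_of_radius_eq_rPlus h₁ f₁ hMa' hM hr w]
  set p : Fin 4 → ℝ := fun μ ↦ fderiv ℝ w x (E4.basisVector μ) with hp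
  have hCS := frameAng_sq_le hx (p + frameIn a x p • dRadius a x) (dRadius a x)
  have hQ := frameAngSq_nonneg hx (p + frameIn a x p • dRadius a x)
  have hrS := sq_le_blSigma_spatial (a := a) hx
  have key := redShift_horizon_algebra (lam := hawkingComp M a x p) (v := frameIn a x p) hδ hS
    (show 2 * scalarH M a x = 1 + frameAngSq a x (dRadius a x) by linarith) hD0 hD1 hQ hrS hCS hh hf
  rw [hr] at key ⊢
  convert key using 2

/-- **The admissible choice `h₁ = f₁ = 16/(r₊ − M)`**: on the horizon of a sub-extremal Kerr black
hole the red-shift multiplier `N` with these parameters has bulk term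
`K^N ≥ (8/(r₊ − M)) λ² + (4/(r₊ − M)) |q̸|² + ((r₊ − M)/(2Σ)) v²`, `r₊ − M = √(M² − a²)`.
(Dafermos–Rodnianski arXiv:0811.0354, Thm. 7.1, with the constants made explicit.)
[cite: DafermosRodnianski2008, Thm. 7.1] -/
theorem redShift_horizon_coercive_sixteen_div (hMa : IsSubextremal M a) (hr : radius a x = rPlus M a)
    (w : E4 → ℝ) :
    8 / (rPlus M a - M) * hawkingComp M a x (fun μ ↦ fderiv ℝ w x (E4.basisVector μ)) ^ 2 +
        4 / (rPlus M a - M) * frameAngSq a x ((fun μ ↦ fderiv ℝ w x (E4.basisVector μ)) +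
          frameIn a x (fun μ ↦ fderiv ℝ w x (E4.basisVector μ)) • dRadius a x) +
        (rPlus M a - M) / (2 * blSigma a (E4.spatial x)) *
          frameIn a x (fun μ ↦ fderiv ℝ w x (E4.basisVector μ)) ^ 2 ≤
      KerrSchild.multiplierBulk (inverseMetric M a)
        (redShiftVector M a (16 / (rPlus M a - M)) (16 / (rPlus M a - M))) w x := by
  have hδ : 0 < rPlus M a - M := by
    rw [rPlus_sub_self]
    refine Real.sqrt_pos.2 (sub_pos.2 ?_)
    have ha : |a| < M := hMa
    have := sq_lt_sq' (abs_lt.1 ha).1 (abs_lt.1 ha).2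
    simpa using this
  have h16 : 16 ≤ (rPlus M a - M) * (16 / (rPlus M a - M)) := by
    rw [mul_div_cancel₀ _ hδ.ne']
  have key := redShift_horizon_coercive hMa hr h16 h16 w
  have e1 : 16 / (rPlus M a - M) / 2 = 8 / (rPlus M a - M) := by ring
  have e2 : 16 / (rPlus M a - M) / 4 = 4 / (rPlus M a - M) := by ring
  rw [e1, e2] at key
  exact key


/-! ### The same in terms of the surface gravity `κ` -/

/-- On the horizon of a sub-extremal Kerr black hole, `r₊ − M = 2 M r₊ κ` (`κ = √(M² − a²)/(2Mr₊)`,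
`r₊ − M = √(M² − a²)`). [cite: Wald1984GR, §12.5 eq. (12.5.4)] -/
theorem rPlus_sub_self_eq_surfaceGravity (hMa : |a| ≤ M) (hM : 0 < M) :
    rPlus M a - M = 2 * M * rPlus M a * surfaceGravity M a := by
  have hr := rPlus_pos hM a
  rw [surfaceGravity_eq_div_two_mul_rPlus hMa, ← rPlus_sub_self, mul_div_cancel₀ _ (by positivity)]

/-- **`κ`-explicit red-shift on the Kerr horizon (the shape of Dafermos–Rodnianski's Thm. 7.1 with
`b ≍ κ` and `σ ≍ κ⁻¹`).** For `|a| < M`, at every point of `𝓗⁺ = {r = r₊}`, the red-shift vector field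
`N = (1 + h₁(r − r₊))K + (1 + f₁(r − r₊))k` with the parameters `h₁ = f₁ = 8/(M²κ)`,
`κ = Kerr.surfaceGravity M a`, satisfies for every `w : E4 → ℝ`
`(κ/2) (λ² + v² + |q̸|²) ≤ K^N(x)`,
`λ = dw(K)`, `v = dw(k)`, `q̸ = dw + v dr`: coercivity constant `κ/2` on the full null-frame energy
density, multiplier parameters of size `16/(M²κ)`, uniformly on the sub-extremal range. (Thresholds:
`(r₊ − M) h₁ = 16 r₊/M ≥ 16`; lower bounds `4/(M²κ) ≥ κ/2`, `2/(M²κ) ≥ κ/2` from `κ ≤ 1/(4M)`, and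
`(r₊ − M)/(2Σ) = Hκ ≥ κ/2` from `2H ≥ 1` on `𝓗⁺`.) [cite: DafermosRodnianski2008, Thm. 7.1] -/
theorem redShift_horizon_coercive_kappa (hMa : IsSubextremal M a) (hr : radius a x = rPlus M a)
    (w : E4 → ℝ) :
    surfaceGravity M a / 2 *
        (hawkingComp M a x (fun μ ↦ fderiv ℝ w x (E4.basisVector μ)) ^ 2 +
          frameIn a x (fun μ ↦ fderiv ℝ w x (E4.basisVector μ)) ^ 2 +
          frameAngSq a x ((fun μ ↦ fderiv ℝ w x (E4.basisVector μ)) +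
            frameIn a x (fun μ ↦ fderiv ℝ w x (E4.basisVector μ)) • dRadius a x)) ≤
      KerrSchild.multiplierBulk (inverseMetric M a)
        (redShiftVector M a (8 / (M ^ 2 * surfaceGravity M a)) (8 / (M ^ 2 * surfaceGravity M a)))
          w x := by
  have hM : 0 < M := hMa.pos
  have hMa' : |a| ≤ M := le_of_lt hMa
  have hx : 0 < radius a x := hr ▸ rPlus_pos hM a
  have hS := blSigma_spatial_pos hx
  have hκ : 0 < surfaceGravity M a := hMa.surfaceGravity_pos
  have hκle : surfaceGravity M a ≤ 1 / (4 * M) := surfaceGravity_le hM a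
  have hrp : M ≤ rPlus M a := by
    linarith [rPlus_sub_self M a, Real.sqrt_nonneg (M ^ 2 - a ^ 2)]
  set κ := surfaceGravity M a with hκ_def
  -- the threshold `(r₊ − M) h₁ = 16 r₊ / M ≥ 16`
  have h16 : 16 ≤ (rPlus M a - M) * (8 / (M ^ 2 * κ)) := by
    rw [rPlus_sub_self_eq_surfaceGravity hMa' hM, ← hκ_def]
    rw [show 2 * M * rPlus M a * κ * (8 / (M ^ 2 * κ)) = 16 * (rPlus M a / M) by
      field_simp; ring]
    have : 1 ≤ rPlus M a / M := by rwa [le_div_iff₀ hM, one_mul]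
    linarith
  have key := redShift_horizon_coercive hMa hr h16 h16 w
  -- the transversal coefficient `(r₊ − M)/(2Σ) = Hκ ≥ κ/2`
  have hc : (rPlus M a - M) / (2 * blSigma a (E4.spatial x)) = scalarH M a x * κ := by
    have h := redShiftCoeff_eq_surfaceGravity hMa' hM hr
    rw [hr] at h
    rw [mul_comm 2, ← div_div, h, ← hκ_def]
    ring
  obtain ⟨hH1, -, -, -⟩ := scalarH_horizon_bounds hMa hr
  have hQ := frameAngSq_nonneg hx ((fun μ ↦ fderiv ℝ w x (E4.basisVector μ)) +
    frameIn a x (fun μ ↦ fderiv ℝ w x (E4.basisVector μ)) • dRadius a x)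
  -- the tangential coefficients `4/(M²κ), 2/(M²κ) ≥ κ/2` (since `Mκ ≤ 1/4`)
  have hMκ : M * κ ≤ 1 / 4 := by
    rw [le_div_iff₀ (by positivity : (0 : ℝ) < 4 * M)] at hκle
    linarith
  have htan : κ / 2 ≤ 8 / (M ^ 2 * κ) / 4 := by
    rw [div_div, div_le_div_iff₀ (by norm_num) (by positivity)]
    nlinarith [mul_pos hM hκ]
  have htan' : κ / 2 ≤ 8 / (M ^ 2 * κ) / 2 := by
    have : 8 / (M ^ 2 * κ) / 4 ≤ 8 / (M ^ 2 * κ) / 2 :=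
      div_le_div_of_nonneg_left (by positivity) (by norm_num) (by norm_num)
    exact htan.trans this
  have htr : κ / 2 ≤ scalarH M a x * κ := by nlinarith
  rw [hc] at key
  refine le_trans ?_ key
  have h1 := mul_le_mul_of_nonneg_right htan'
    (sq_nonneg (hawkingComp M a x (fun μ ↦ fderiv ℝ w x (E4.basisVector μ))))
  have h2 := mul_le_mul_of_nonneg_right htan hQ
  have h3 := mul_le_mul_of_nonneg_right htr
    (sq_nonneg (frameIn a x (fun μ ↦ fderiv ℝ w x (E4.basisVector μ))))
  nlinarith [h1, h2, h3]

end Literature.Geometry.Lorentzian.Kerr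

end
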